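import Literature.Analysis.FluidPDE.NSSliceTimeIncrement
import Literature.Analysis.FluidPDE.NSLerayHopfSereginProfile
import Literature.Analysis.FluidPDE.LocalTypeI
import HarnessLib

/-!
# Crux `TerminalTrace.TypeITraceScarL3` (stmt-NavierStokesRegularity-18385), line `extinct-apex`,
# STUB 2 support file 1: time pairings of a suitable weak solution in a BACKWARD parabolic ball
# with spatial test fields — the a.e. primitive representation up to the TOP time and the
# uniform modulus of the increments in terms of Albritton–Barker's `A` and the `L^{3/2}` pressure

Prover seat nsreg-p4 (gen 15) for the planner nsreg-p2 (ROUND-24 «the scar at the last slice»,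
skeleton `HOME/ns-regularity-ideate-p2/R24-line-extinct-apex.lean`, sha16 07e82d2c7e70161a;
`--supports stmt-NavierStokesRegularity-18385`).  Theorems only.

For a pair `(u, p)` which is a distributional solution of the unit-viscosity Navier–Stokes system
in the backward parabolic ball `Q(z, R) = ]t − R², t[ × B(x, R)` with `u, |u|², p ∈ L¹(Q(z, R))`
(in particular for Albritton–Barker's class Def. 2.1, `IsSuitableWeakSolutionInBall`), and a
spatial test field `η ∈ C_c^∞(B(x, R))`, the pairing `g(s) = ∫_B ⟪u(s), η⟫` satisfies
`∫ (χ' g + χ f) = 0` for all `χ ∈ C_c^∞(]t − R², t[)` with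
`f = ∫_B (⟪u, Dη u⟫ + ⟪u, Δη⟫ + p div η)` (the tree's `setIntegral_deriv_mul_pairing_add_eq_zero`
of `NSSliceTimePairing.lean`, there for BOUNDED solutions in CENTRED cylinders; here the quadratic
term is controlled by `|u|² ∈ L¹` as in `LocalLerayPairingContinuity.lean`).  By du Bois-Reymond
(`exists_ae_eq_const_add_primitive`) `g = c + ∫ f` a.e.; if moreover `g(s) → L` as `s ↑ t`
(the weakly continuous top value), then `g(s) = L − ∫_s^t f` for a.e. `s`
(`ae_pairing_eq_top_sub_integral`), and `∫_s^t |f| ≤ (K₁A + K₂(|B| + A))(t − s)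
+ 3K₁ ‖p‖_{L^{3/2}(Q)} |B|^{1/3} (t − s)^{1/3}` where `A` bounds `∫_B |u(τ)|²` for a.e. `τ`
(Albritton–Barker's `r·A(Q(z,R))`) and `‖Dη‖ ≤ K₁`, `‖Δη‖ ≤ K₂` (`integral_abs_remainder_le`):
the increments of the pairing are controlled UNIFORMLY along any family with bounded `A` and
bounded `L^{3/2}` pressure — the modulus used to show that the zoom limit at an `L³` apex has a
null weak top trace (Seregin, *Lecture notes on regularity theory for the Navier–Stokes
equations* (2014), Prop. 6.20; Robinson–Rodrigo–Sadowski 2016, Lemma 13.8).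

WHAT THIS IS NOT: not a regularity or blow-up claim — time-regularity bookkeeping of weak
solutions; the crux `TypeITraceScarL3` and its open stub `stub_no_extinctApex` are untouched.
-/

noncomputable section

open MeasureTheory Set Function Filter Topology TopologicalSpace Metric intervalIntegral
open scoped NNReal ENNReal InnerProductSpace RealInnerProductSpace Laplacian

namespace Summit.NavierStokesRegularity.NavierStokesRegularity.Theorems.TerminalTraceExtinctApexPairing

open Literature.Analysis Literature.Analysis.FluidPDE

variable {u : ℝ → (EuclideanSpace ℝ (Fin 3)) → (EuclideanSpace ℝ (Fin 3))} {p : ℝ → (EuclideanSpace ℝ (Fin 3)) → ℝ} {z : ℝ × (EuclideanSpace ℝ (Fin 3))} {R : ℝ}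

/-! ## The backward parabolic ball as a product; integrability -/

/-- The backward parabolic ball is the product of its time window and its ball. -/
theorem parabolicCylinder_eq_prod (R : ℝ) (z : ℝ × (EuclideanSpace ℝ (Fin 3))) :
    parabolicCylinder R z = Ioo (z.1 - R ^ 2) z.1 ×ˢ ball z.2 R := rfl

/-- The volume restricted to the backward parabolic ball is the product of the restricted volumes. -/
theorem volume_restrict_parabolicCylinder (R : ℝ) (z : ℝ × (EuclideanSpace ℝ (Fin 3))) :
    (volume : Measure (ℝ × (EuclideanSpace ℝ (Fin 3)))).restrict (parabolicCylinder R z) =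
      ((volume : Measure ℝ).restrict (Ioo (z.1 - R ^ 2) z.1)).prod
        ((volume : Measure (EuclideanSpace ℝ (Fin 3))).restrict (ball z.2 R)) := by
  rw [parabolicCylinder_eq_prod, Measure.volume_eq_prod, Measure.prod_restrict]

/-- A time–space box has volume `|I| · |B|`. -/
theorem volume_Ioo_prod_ball (a b : ℝ) (x : (EuclideanSpace ℝ (Fin 3))) (R : ℝ) :
    (volume : Measure (ℝ × (EuclideanSpace ℝ (Fin 3)))) (Ioo a b ×ˢ ball x R) =
      ENNReal.ofReal (b - a) * volume (ball x R) := by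
  rw [Measure.volume_eq_prod, Measure.prod_prod, Real.volume_Ioo]

/-- The backward parabolic ball has finite volume. -/
theorem volume_parabolicCylinder_lt_top' (R : ℝ) (z : ℝ × (EuclideanSpace ℝ (Fin 3))) :
    (volume : Measure (ℝ × (EuclideanSpace ℝ (Fin 3)))) (parabolicCylinder R z) < ∞ := by
  rw [parabolicCylinder_eq_prod, volume_Ioo_prod_ball]
  exact ENNReal.mul_lt_top ENNReal.ofReal_lt_top measure_ball_lt_top

/-- The volume restricted to the backward parabolic ball is a finite measure. -/
theorem isFiniteMeasure_restrict_parabolicCylinder' (R : ℝ) (z : ℝ × (EuclideanSpace ℝ (Fin 3))) :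
    IsFiniteMeasure ((volume : Measure (ℝ × (EuclideanSpace ℝ (Fin 3)))).restrict (parabolicCylinder R z)) :=
  ⟨by rw [Measure.restrict_apply_univ]; exact volume_parabolicCylinder_lt_top' R z⟩

/-- `‖ ‖v‖² ‖ₑ = ‖v‖ₑ²`. -/
theorem enorm_norm_sq (v : (EuclideanSpace ℝ (Fin 3))) : ‖‖v‖ ^ 2‖ₑ = ‖v‖ₑ ^ 2 := by
  rw [Real.enorm_eq_ofReal (sq_nonneg _), ENNReal.ofReal_pow (norm_nonneg _), ofReal_norm]

/-- **Integrability of the data of a suitable weak solution in a parabolic ball.**  In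
Albritton–Barker's class Def. 2.1 on `Q(z, R)`, with `∫_B |u(τ)|² ≤ A < ∞` for a.e. `τ` (the class
provides such an `A`), `u`, `|u|²` and `p` are integrable on `Q(z, R)`. -/
theorem integrable_data (h : IsSuitableWeakSolutionInBall R z u p)
    {A : ℝ≥0∞} (hAtop : A ≠ ⊤)
    (hA : ∀ᵐ t ∂(volume.restrict (Ioo (z.1 - R ^ 2) z.1)), ∫⁻ x in ball z.2 R, ‖u t x‖ₑ ^ 2 ≤ A) :
    IntegrableOn (uncurry u) (parabolicCylinder R z) volume ∧
      IntegrableOn (fun w => ‖uncurry u w‖ ^ 2) (parabolicCylinder R z) volume ∧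
      IntegrableOn (uncurry p) (parabolicCylinder R z) volume := by
  haveI := isFiniteMeasure_restrict_parabolicCylinder' R z
  have hum : AEStronglyMeasurable (uncurry u) (volume.restrict (parabolicCylinder R z)) :=
    h.1.distributional.1.aestronglyMeasurable
  -- `∫∫ |u|² ≤ A R²`
  have hlin : ∫⁻ w in parabolicCylinder R z, ‖uncurry u w‖ₑ ^ 2 ≤ A * ENNReal.ofReal (R ^ 2) := by
    rw [volume_restrict_parabolicCylinder,
      lintegral_prod _ (by
        have := hum.enorm.pow_const 2
        rw [volume_restrict_parabolicCylinder] at this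
        exact this)]
    calc ∫⁻ t in Ioo (z.1 - R ^ 2) z.1, ∫⁻ x in ball z.2 R, ‖uncurry u (t, x)‖ₑ ^ 2
        ≤ ∫⁻ _t in Ioo (z.1 - R ^ 2) z.1, A := lintegral_mono_ae hA
      _ = A * ENNReal.ofReal (R ^ 2) := by
          rw [lintegral_const, Measure.restrict_apply_univ, Real.volume_Ioo]
          ring_nf
  have hu2 : IntegrableOn (fun w => ‖uncurry u w‖ ^ 2) (parabolicCylinder R z) volume := by
    refine ⟨hum.norm.pow 2, ?_⟩
    rw [hasFiniteIntegral_iff_enorm]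
    calc ∫⁻ w in parabolicCylinder R z, ‖‖uncurry u w‖ ^ 2‖ₑ
        = ∫⁻ w in parabolicCylinder R z, ‖uncurry u w‖ₑ ^ 2 := lintegral_congr fun w => enorm_norm_sq _
      _ ≤ A * ENNReal.ofReal (R ^ 2) := hlin
      _ < ⊤ := ENNReal.mul_lt_top hAtop.lt_top ENNReal.ofReal_lt_top
  have hu : IntegrableOn (uncurry u) (parabolicCylinder R z) volume := by
    refine Integrable.mono' ((integrable_const (1 : ℝ)).add hu2) hum (Eventually.of_forall fun w => ?_)
    simp only [Pi.add_apply]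
    nlinarith [sq_nonneg (‖uncurry u w‖ - 1 / 2)]
  have hp : IntegrableOn (uncurry p) (parabolicCylinder R z) volume :=
    (h.2.2.2.mono_exponent (by
      rw [ENNReal.le_div_iff_mul_le (by norm_num) (by norm_num)]; norm_num)).integrable le_rfl
  exact ⟨hu, hu2, hp⟩

/-! ## Testing the momentum equation with `χ(t) η(x)` in a backward parabolic ball -/

/-- The pairing integrand `⟪u, η⟫` is integrable on the ball `Q(z, R)`. -/
theorem integrable_inner_test (hu : IntegrableOn (uncurry u) (parabolicCylinder R z) volume)
    {η : (EuclideanSpace ℝ (Fin 3)) → (EuclideanSpace ℝ (Fin 3))} (hηc : Continuous η) {K₀ : ℝ} (hK₀ : ∀ x, ‖η x‖ ≤ K₀) :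
    Integrable (fun w : ℝ × (EuclideanSpace ℝ (Fin 3)) => ⟪u w.1 w.2, η w.2⟫)
      (volume.restrict (parabolicCylinder R z)) := by
  refine Integrable.mono' (hu.norm.mul_const K₀)
    (hu.1.inner (hηc.comp continuous_snd).aestronglyMeasurable) (Eventually.of_forall fun w => ?_)
  exact (norm_inner_le_norm _ _).trans (mul_le_mul_of_nonneg_left (hK₀ w.2) (norm_nonneg _))

/-- The remainder `⟪u, Dη u⟫ + ⟪u, Δη⟫ + p div η` is integrable on `Q(z, R)` and dominated by
`K₁ |u|² + K₂ |u| + 3K₁ |p|`. -/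
theorem integrable_remainder_test (hu : IntegrableOn (uncurry u) (parabolicCylinder R z) volume)
    (hu2 : IntegrableOn (fun w => ‖uncurry u w‖ ^ 2) (parabolicCylinder R z) volume)
    (hpi : IntegrableOn (uncurry p) (parabolicCylinder R z) volume)
    {η : (EuclideanSpace ℝ (Fin 3)) → (EuclideanSpace ℝ (Fin 3))} (hη1 : ContDiff ℝ 2 η) {K₁ K₂ : ℝ} (hK₁ : ∀ x, ‖fderiv ℝ η x‖ ≤ K₁)
    (hK₂ : ∀ x, ‖Δ η x‖ ≤ K₂) :
    Integrable (fun w : ℝ × (EuclideanSpace ℝ (Fin 3)) => ⟪u w.1 w.2, fderiv ℝ η w.2 (u w.1 w.2)⟫ + ⟪u w.1 w.2, Δ η w.2⟫ +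
        p w.1 w.2 * VectorCalculus.divergence η w.2)
      (volume.restrict (parabolicCylinder R z)) ∧
    ∀ w : ℝ × (EuclideanSpace ℝ (Fin 3)), ‖⟪u w.1 w.2, fderiv ℝ η w.2 (u w.1 w.2)⟫ + ⟪u w.1 w.2, Δ η w.2⟫ +
        p w.1 w.2 * VectorCalculus.divergence η w.2‖ ≤
      K₁ * ‖uncurry u w‖ ^ 2 + K₂ * ‖uncurry u w‖ + 3 * K₁ * ‖uncurry p w‖ := by
  have cD : Continuous (fderiv ℝ η) := hη1.continuous_fderiv (by simp)
  have cL : Continuous (Δ η) := continuous_laplacian hη1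
  have hdiv : Continuous (VectorCalculus.divergence η) := continuous_divergence cD
  have b1 : ∀ w : ℝ × (EuclideanSpace ℝ (Fin 3)), ‖⟪u w.1 w.2, fderiv ℝ η w.2 (u w.1 w.2)⟫‖ ≤ K₁ * ‖uncurry u w‖ ^ 2 := by
    intro w
    calc ‖⟪u w.1 w.2, fderiv ℝ η w.2 (u w.1 w.2)⟫‖
        ≤ ‖u w.1 w.2‖ * ‖fderiv ℝ η w.2 (u w.1 w.2)‖ := norm_inner_le_norm _ _
      _ ≤ ‖u w.1 w.2‖ * (K₁ * ‖u w.1 w.2‖) := by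
          gcongr
          exact (ContinuousLinearMap.le_opNorm _ _).trans
            (mul_le_mul_of_nonneg_right (hK₁ w.2) (norm_nonneg _))
      _ = K₁ * ‖uncurry u w‖ ^ 2 := by simp only [uncurry]; ring
  have b2 : ∀ w : ℝ × (EuclideanSpace ℝ (Fin 3)), ‖⟪u w.1 w.2, Δ η w.2⟫‖ ≤ K₂ * ‖uncurry u w‖ := fun w =>
    (norm_inner_le_norm _ _).trans (by
      rw [mul_comm]
      exact mul_le_mul_of_nonneg_right (hK₂ w.2) (norm_nonneg _))
  have b3 : ∀ w : ℝ × (EuclideanSpace ℝ (Fin 3)), ‖p w.1 w.2 * VectorCalculus.divergence η w.2‖ ≤ 3 * K₁ * ‖uncurry p w‖ := by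
    intro w
    rw [norm_mul, mul_comm]
    exact mul_le_mul_of_nonneg_right (norm_divergence_le_three_mul hK₁ w.2) (norm_nonneg _)
  refine ⟨?_, fun w => ?_⟩
  · have i1 : Integrable (fun w : ℝ × (EuclideanSpace ℝ (Fin 3)) => ⟪u w.1 w.2, fderiv ℝ η w.2 (u w.1 w.2)⟫)
        (volume.restrict (parabolicCylinder R z)) := by
      have hm : AEStronglyMeasurable (fun w : ℝ × (EuclideanSpace ℝ (Fin 3)) => ⟪u w.1 w.2, fderiv ℝ η w.2 (u w.1 w.2)⟫)
          (volume.restrict (parabolicCylinder R z)) :=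
        hu.1.inner (isBoundedBilinearMap_apply.continuous.comp_aestronglyMeasurable
          ((cD.comp continuous_snd).aestronglyMeasurable.prodMk hu.1))
      exact Integrable.mono' (hu2.const_mul K₁) hm (Eventually.of_forall b1)
    have i2 : Integrable (fun w : ℝ × (EuclideanSpace ℝ (Fin 3)) => ⟪u w.1 w.2, Δ η w.2⟫)
        (volume.restrict (parabolicCylinder R z)) :=
      Integrable.mono' (hu.norm.const_mul K₂)
        (hu.1.inner (cL.comp continuous_snd).aestronglyMeasurable) (Eventually.of_forall b2)
    have i3 : Integrable (fun w : ℝ × (EuclideanSpace ℝ (Fin 3)) => p w.1 w.2 * VectorCalculus.divergence η w.2)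
        (volume.restrict (parabolicCylinder R z)) := by
      have e : (fun w : ℝ × (EuclideanSpace ℝ (Fin 3)) => p w.1 w.2 * VectorCalculus.divergence η w.2) =
          fun w => VectorCalculus.divergence η w.2 * uncurry p w := by
        ext w; simp [uncurry, mul_comm]
      rw [e]
      exact hpi.bdd_mul (hdiv.comp continuous_snd).aestronglyMeasurable
        (Eventually.of_forall fun w => norm_divergence_le_three_mul hK₁ w.2)
    exact (i1.add i2).add i3
  · calc ‖⟪u w.1 w.2, fderiv ℝ η w.2 (u w.1 w.2)⟫ + ⟪u w.1 w.2, Δ η w.2⟫ +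
          p w.1 w.2 * VectorCalculus.divergence η w.2‖
        ≤ ‖⟪u w.1 w.2, fderiv ℝ η w.2 (u w.1 w.2)⟫ + ⟪u w.1 w.2, Δ η w.2⟫‖ +
          ‖p w.1 w.2 * VectorCalculus.divergence η w.2‖ := norm_add_le _ _
      _ ≤ (‖⟪u w.1 w.2, fderiv ℝ η w.2 (u w.1 w.2)⟫‖ + ‖⟪u w.1 w.2, Δ η w.2⟫‖) +
          ‖p w.1 w.2 * VectorCalculus.divergence η w.2‖ := by
          gcongr; exact norm_add_le _ _
      _ ≤ (K₁ * ‖uncurry u w‖ ^ 2 + K₂ * ‖uncurry u w‖) + 3 * K₁ * ‖uncurry p w‖ :=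
          add_le_add (add_le_add (b1 w) (b2 w)) (b3 w)

/-- **Testing the momentum equation with `χ(t) η(x)` in a backward parabolic ball.**  For a
distributional solution `(u, p)` (unit viscosity, no force) in `Q(z, R) = I × B` with `u`, `|u|²`,
`p` integrable there, a smooth `χ` compactly supported in the time window `I` and a test field `η`
on the ball `B`, `∫_I (χ'(t) ∫_B ⟪u(t), η⟫ + χ(t) ∫_B (⟪u, Dη u⟫ + ⟪u, Δη⟫ + p div η)(t)) dt = 0`
(the distributional identity for `ψ = χ ⊗ η` followed by Fubini; twin of the tree's
`setIntegral_deriv_mul_pairing_add_eq_zero` for centred cylinders). -/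
theorem setIntegral_deriv_mul_pairing_add_eq_zero_ball
    (hsol : IsDistributionalNSSolutionOn (parabolicCylinderOpens R z) 1 0 u p)
    (hu : IntegrableOn (uncurry u) (parabolicCylinder R z) volume)
    (hu2 : IntegrableOn (fun w => ‖uncurry u w‖ ^ 2) (parabolicCylinder R z) volume)
    (hpi : IntegrableOn (uncurry p) (parabolicCylinder R z) volume)
    {χ : ℝ → ℝ} (hχ : ContDiff ℝ (⊤ : ℕ∞) χ) (hχc : HasCompactSupport χ)
    (hχI : tsupport χ ⊆ Ioo (z.1 - R ^ 2) z.1)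
    {η : (EuclideanSpace ℝ (Fin 3)) → (EuclideanSpace ℝ (Fin 3))} (hη : FunctionSpaces.IsTestFunctionOn ⟨ball z.2 R, isOpen_ball⟩ η) :
    ∫ t in Ioo (z.1 - R ^ 2) z.1,
      ((deriv χ t * ∫ x in ball z.2 R, ⟪u t x, η x⟫) +
        χ t * ∫ x in ball z.2 R, (⟪u t x, fderiv ℝ η x (u t x)⟫ + ⟪u t x, Δ η x⟫ +
          p t x * VectorCalculus.divergence η x)) = 0 := by
  obtain ⟨K₀, K₁, K₂, hK₀, hK₁, hK₂⟩ := exists_bounds_of_isTestFunctionOn hη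
  have hηd : Differentiable ℝ η := hη.contDiff.differentiable (by simp)
  have hη2 : ContDiff ℝ 2 η := hη.contDiff.of_le (by norm_cast)
  have hχd : Differentiable ℝ χ := hχ.differentiable (by simp)
  obtain ⟨Cχ, hCχ⟩ := hχ.continuous.bounded_above_of_compact_support hχc
  obtain ⟨Cχ', hCχ'⟩ := (hχ.continuous_deriv (by simp)).bounded_above_of_compact_support hχc.deriv
  -- the distributional identity for `ψ = χ ⊗ η`
  have hψ : IsSpaceTimeTestOn (parabolicCylinderOpens R z) (fun s x => χ s • η x) :=
    isSpaceTimeTestOn_prod_smul isOpen_Ioo isOpen_ball hχ hχc hχI hη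
  have key := hsol.2.2.2.2 _ hψ
  set G : ℝ × (EuclideanSpace ℝ (Fin 3)) → ℝ := fun w => ⟪u w.1 w.2, fderiv ℝ η w.2 (u w.1 w.2)⟫ + ⟪u w.1 w.2, Δ η w.2⟫ +
    p w.1 w.2 * VectorCalculus.divergence η w.2 with hG
  have iU : Integrable (fun w : ℝ × (EuclideanSpace ℝ (Fin 3)) => ⟪u w.1 w.2, η w.2⟫)
      (volume.restrict (parabolicCylinder R z)) :=
    integrable_inner_test hu hη.contDiff.continuous hK₀
  have iG : Integrable G (volume.restrict (parabolicCylinder R z)) :=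
    (integrable_remainder_test hu hu2 hpi hη2 hK₁ hK₂).1
  have iU' : Integrable (fun w : ℝ × (EuclideanSpace ℝ (Fin 3)) => deriv χ w.1 * ⟪u w.1 w.2, η w.2⟫)
      (volume.restrict (parabolicCylinder R z)) :=
    integrable_time_mul iU (hχ.continuous_deriv (by simp)) (C := Cχ')
      fun s => by simpa [Real.norm_eq_abs] using hCχ' s
  have iG' : Integrable (fun w : ℝ × (EuclideanSpace ℝ (Fin 3)) => χ w.1 * G w)
      (volume.restrict (parabolicCylinder R z)) :=
    integrable_time_mul iG hχ.continuous (C := Cχ) fun s => by simpa [Real.norm_eq_abs] using hCχ s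
  -- rewrite the tested integrand
  have key' : ∫ w in parabolicCylinder R z,
      (deriv χ w.1 * ⟪u w.1 w.2, η w.2⟫ + χ w.1 * G w) = 0 := by
    refine Eq.trans (setIntegral_congr_fun
      (isOpen_parabolicCylinder R z).measurableSet fun w _ => ?_) key
    rw [hG]
    dsimp only
    rw [timeDeriv_prod_smul hχd, convect_fun_const_smul _ (hηd w.2),
      laplacian_fun_const_smul hη2, divergence_fun_const_smul (hηd w.2)]
    simp only [inner_smul_right, Pi.zero_apply, inner_zero_left, one_mul, convect]
    ring
  -- Fubini
  rw [volume_restrict_parabolicCylinder] at key' iU iG iU' iG'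
  have iS : Integrable (fun w : ℝ × (EuclideanSpace ℝ (Fin 3)) => deriv χ w.1 * ⟪u w.1 w.2, η w.2⟫ + χ w.1 * G w)
      (((volume : Measure ℝ).restrict (Ioo (z.1 - R ^ 2) z.1)).prod
        ((volume : Measure (EuclideanSpace ℝ (Fin 3))).restrict (ball z.2 R))) := iU'.add iG'
  rw [integral_prod _ iS] at key'
  have hae : ∀ᵐ t ∂((volume : Measure ℝ).restrict (Ioo (z.1 - R ^ 2) z.1)),
      (∫ x in ball z.2 R, (deriv χ t * ⟪u t x, η x⟫ + χ t * G (t, x))) =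
        (deriv χ t * ∫ x in ball z.2 R, ⟪u t x, η x⟫) +
          χ t * ∫ x in ball z.2 R, (⟪u t x, fderiv ℝ η x (u t x)⟫ + ⟪u t x, Δ η x⟫ +
            p t x * VectorCalculus.divergence η x) := by
    filter_upwards [iU.prod_right_ae, iG.prod_right_ae] with t h1 h2
    rw [integral_add (h1.const_mul _) (h2.const_mul _), MeasureTheory.integral_const_mul,
      MeasureTheory.integral_const_mul]
  rw [← integral_congr_ae hae]
  exact key'

/-- **The pairing and the tested remainder are integrable in time** on the window of `Q(z, R)`. -/
theorem integrableOn_pairing_ball (hu : IntegrableOn (uncurry u) (parabolicCylinder R z) volume)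
    (hu2 : IntegrableOn (fun w => ‖uncurry u w‖ ^ 2) (parabolicCylinder R z) volume)
    (hpi : IntegrableOn (uncurry p) (parabolicCylinder R z) volume)
    {η : (EuclideanSpace ℝ (Fin 3)) → (EuclideanSpace ℝ (Fin 3))} (hη : FunctionSpaces.IsTestFunctionOn ⟨ball z.2 R, isOpen_ball⟩ η) :
    IntegrableOn (fun t => ∫ x in ball z.2 R, ⟪u t x, η x⟫) (Ioo (z.1 - R ^ 2) z.1) volume ∧
      IntegrableOn (fun t => ∫ x in ball z.2 R, (⟪u t x, fderiv ℝ η x (u t x)⟫ + ⟪u t x, Δ η x⟫ +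
        p t x * VectorCalculus.divergence η x)) (Ioo (z.1 - R ^ 2) z.1) volume ∧
      IntegrableOn (fun t => ∫ x in ball z.2 R, ‖⟪u t x, fderiv ℝ η x (u t x)⟫ + ⟪u t x, Δ η x⟫ +
        p t x * VectorCalculus.divergence η x‖) (Ioo (z.1 - R ^ 2) z.1) volume := by
  obtain ⟨K₀, K₁, K₂, hK₀, hK₁, hK₂⟩ := exists_bounds_of_isTestFunctionOn hη
  have hη2 : ContDiff ℝ 2 η := hη.contDiff.of_le (by norm_cast)
  have iU := integrable_inner_test hu hη.contDiff.continuous hK₀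
  have iG := (integrable_remainder_test hu hu2 hpi hη2 hK₁ hK₂).1
  rw [volume_restrict_parabolicCylinder] at iU iG
  exact ⟨iU.integral_prod_left, iG.integral_prod_left, iG.integral_norm_prod_left⟩

/-! ## The a.e. representation of the pairing from the top time -/

/-- **The pairing from the top time.**  If `(u, p)` is distributional in `Q(z, R)` with integrable
data and the pairing `g(s) = ∫_B ⟪u(s), η⟫` with a test field `η` on `B = B(z.2, R)` tends to `L`
as `s ↑ z.1` (the weakly continuous top value), then for a.e. `s` in the time window
`g(s) = L − ∫_s^{z.1} f`, `f = ∫_B (⟪u, Dη u⟫ + ⟪u, Δη⟫ + p div η)` (du Bois-Reymond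
`exists_ae_eq_const_add_primitive`; the constant is pinned by the top value along the non-trivial
filter `𝓝[<] z.1 ⊓ ae`). -/
theorem ae_pairing_eq_top_sub_integral
    (hsol : IsDistributionalNSSolutionOn (parabolicCylinderOpens R z) 1 0 u p)
    (hu : IntegrableOn (uncurry u) (parabolicCylinder R z) volume)
    (hu2 : IntegrableOn (fun w => ‖uncurry u w‖ ^ 2) (parabolicCylinder R z) volume)
    (hpi : IntegrableOn (uncurry p) (parabolicCylinder R z) volume) (hR : 0 < R)
    {η : (EuclideanSpace ℝ (Fin 3)) → (EuclideanSpace ℝ (Fin 3))} (hη : FunctionSpaces.IsTestFunctionOn ⟨ball z.2 R, isOpen_ball⟩ η) {L : ℝ}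
    (hL : Tendsto (fun s => ∫ x in ball z.2 R, ⟪u s x, η x⟫) (𝓝[<] z.1) (𝓝 L)) :
    ∀ᵐ s ∂(volume.restrict (Ioo (z.1 - R ^ 2) z.1)),
      (∫ x in ball z.2 R, ⟪u s x, η x⟫) =
        L - ∫ t in s..z.1, ∫ x in ball z.2 R, (⟪u t x, fderiv ℝ η x (u t x)⟫ + ⟪u t x, Δ η x⟫ +
          p t x * VectorCalculus.divergence η x) := by
  set a : ℝ := z.1 - R ^ 2 with ha
  have haz : a < z.1 := by rw [ha]; nlinarith
  set g : ℝ → ℝ := fun s => ∫ x in ball z.2 R, ⟪u s x, η x⟫ with hg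
  set f : ℝ → ℝ := fun t => ∫ x in ball z.2 R, (⟪u t x, fderiv ℝ η x (u t x)⟫ + ⟪u t x, Δ η x⟫ +
    p t x * VectorCalculus.divergence η x) with hf
  obtain ⟨hgI, hfI, -⟩ := integrableOn_pairing_ball hu hu2 hpi hη
  obtain ⟨c, hc⟩ := exists_ae_eq_const_add_primitive hgI hfI fun χ hχ hχc hχI =>
    setIntegral_deriv_mul_pairing_add_eq_zero_ball hsol hu hu2 hpi hχ hχc hχI hη
  -- the continuous primitive and its value at the top
  set V : ℝ → ℝ := fun t => c + ∫ s in Ioc a t, f s with hV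
  have hfI' : IntegrableOn f (Icc a z.1) volume :=
    (integrableOn_Icc_iff_integrableOn_Ioo (by simp) (by simp)).2 hfI
  have hVc : ContinuousOn V (Icc a z.1) :=
    continuousOn_const.add (intervalIntegral.continuousOn_primitive hfI')
  haveI := nhdsLT_inf_ae_neBot z.1
  have h1 : Tendsto g (𝓝[<] z.1 ⊓ ae (volume : Measure ℝ)) (𝓝 L) := hL.mono_left inf_le_left
  have h2 : Tendsto V (𝓝[<] z.1 ⊓ ae (volume : Measure ℝ)) (𝓝 (V z.1)) := by
    have h := (hVc.continuousWithinAt (right_mem_Icc.2 haz.le)).tendsto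
    refine (h.mono_left ?_).mono_left inf_le_left
    rw [← nhdsWithin_Ioo_eq_nhdsLT haz]
    exact nhdsWithin_mono _ Ioo_subset_Icc_self
  have h3 : g =ᶠ[𝓝[<] z.1 ⊓ ae (volume : Measure ℝ)] V := by
    have hA : ∀ᶠ t in 𝓝[<] z.1 ⊓ ae (volume : Measure ℝ), t ∈ Ioo a z.1 :=
      mem_inf_of_left (Ioo_mem_nhdsLT haz)
    have hB : ∀ᶠ t in 𝓝[<] z.1 ⊓ ae (volume : Measure ℝ), t ∈ Ioo a z.1 → g t = V t :=
      mem_inf_of_right ((ae_restrict_iff' measurableSet_Ioo).1 hc)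
    filter_upwards [hA, hB] with t ht h using h ht
  have hVL : V z.1 = L := tendsto_nhds_unique h2 (h1.congr' h3)
  -- the a.e. identity
  filter_upwards [hc, ae_restrict_mem measurableSet_Ioo] with s hs hsI
  have hint1 : IntervalIntegrable f volume a z.1 :=
    (intervalIntegrable_iff_integrableOn_Ioo_of_le haz.le).2 hfI
  have hint2 : IntervalIntegrable f volume a s :=
    (intervalIntegrable_iff_integrableOn_Ioo_of_le hsI.1.le).2 (hfI.mono_set (Ioo_subset_Ioo_right hsI.2.le))
  have e1 : ∫ t in s..z.1, f t = (∫ t in a..z.1, f t) - ∫ t in a..s, f t :=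
    (intervalIntegral.integral_interval_sub_left hint1 hint2).symm
  have e2 : V z.1 = c + ∫ t in a..z.1, f t := by
    rw [hV, intervalIntegral.integral_of_le haz.le]
  have e3 : V s = c + ∫ t in a..s, f t := by
    rw [hV, intervalIntegral.integral_of_le hsI.1.le]
  show g s = L - ∫ t in s..z.1, f t
  calc g s = c + ∫ t in Ioc a s, f t := hs
    _ = c + ∫ t in a..s, f t := by rw [intervalIntegral.integral_of_le hsI.1.le]
    _ = L - ∫ t in s..z.1, f t := by rw [e1, ← hVL, e2]; ring

end Summit.NavierStokesRegularity.NavierStokesRegularity.Theorems.TerminalTraceExtinctApexPairing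

end
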